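import Summits.Ventures.Crystal3D.Theorems.StickyWulffConstantNoReconstructionGainTwoFamilyLocal
import HarnessLib

/-!
# Two Barlow families at once: the slot count and the six basal blocking distances

HONEST FRAMING. Part of the venture `Summits/Ventures/Crystal3D` (cell `crystal3d-full`), helper
`--supports` the crux `NoReconstructionGain` (stmt-Ventures-19144, route
`route-Ventures-StickyWulffConstant`), line `adhesion`; continuation of `…TwoFamilyLocal`, used by
the per-ball lemma `twoFamily_lattice_noGainPotential` (`…TwoFamilyLattice`).

* `slots_count_le_five_bool`, `slots_count_le_five` — the combinatorial heart of the lattice-ball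
  count: eleven occupancy booleans (five bond slots `t, t−u, t−v, u, v`, six twin-hollow slots
  `A, B₁, B₂, RA, RB₁, RB₂`) under the blocking relations (a twin hollow empties its two adjacent bond
  slots; `B₁` and `RB₂` exclude each other) sum to at most `5` — decided over `2¹¹` cases;
* `length_filter_cons_toNat` — bookkeeping for filtered explicit lists;
* `twinHollow_block_norms` — the six squared distances `1/3` between a basal twin hollow and its two
  adjacent up-bonds.

WHAT THIS IS NOT: any statement about packings; rung F-C1 not moved.
-/

noncomputable section

namespace Summit.Ventures.Crystal3D.Theorems

open Summit.Ventures.Crystal3D Finset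
open Literature.MathematicalPhysics.StatisticalMechanics (barlowPos barlowStacking fccStacking
  barlowOffset constHagg haggLabel_const barlowPos_apply_zero barlowPos_apply_one barlowPos_apply_two
  orderedContacts contactDeficiency)
open scoped InnerProductSpace

/-! ### The boolean count -/

/-- The slot count behind the lattice-ball lemma, as a decision over `2¹¹` cases. -/
theorem slots_count_le_five_bool :
    ∀ st stu stv su sv aA aB1 aB2 bA bB1 bB2 : Bool,
    ((!aA || (!stu && !stv)) && (!aB1 || (!st && !stv)) && (!aB2 || (!st && !stu)) &&
      (!bA || (!su && !sv)) && (!bB1 || (!st && !sv)) && (!bB2 || (!st && !su)) &&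
      (!aB1 || !bB2)) = true →
    st.toNat + stu.toNat + stv.toNat + su.toNat + sv.toNat + aA.toNat + aB1.toNat + aB2.toNat +
      bA.toNat + bB1.toNat + bB2.toNat ≤ 5 := by
  decide

/-- The slot count: occupancy booleans of the five bond slots `t, t−u, t−v, u, v` and the six
twin-hollow slots `A, B₁, B₂, RA, RB₁, RB₂` (all with the sign `c`), under the blocking relations,
sum to at most `5`. -/
theorem slots_count_le_five (st stu stv su sv aA aB1 aB2 bA bB1 bB2 : Bool)
    (h1 : aA = true → stu = false) (h2 : aA = true → stv = false)
    (h3 : aB1 = true → st = false) (h4 : aB1 = true → stv = false)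
    (h5 : aB2 = true → st = false) (h6 : aB2 = true → stu = false)
    (h7 : bA = true → su = false) (h8 : bA = true → sv = false)
    (h9 : bB1 = true → st = false) (h10 : bB1 = true → sv = false)
    (h11 : bB2 = true → st = false) (h12 : bB2 = true → su = false)
    (h13 : aB1 = true → bB2 = false) :
    st.toNat + stu.toNat + stv.toNat + su.toNat + sv.toNat + aA.toNat + aB1.toNat + aB2.toNat +
      bA.toNat + bB1.toNat + bB2.toNat ≤ 5 := by
  have g1 : (!aA || (!stu && !stv)) = true := by cases aA <;> simp_all
  have g2 : (!aB1 || (!st && !stv)) = true := by cases aB1 <;> simp_all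
  have g3 : (!aB2 || (!st && !stu)) = true := by cases aB2 <;> simp_all
  have g4 : (!bA || (!su && !sv)) = true := by cases bA <;> simp_all
  have g5 : (!bB1 || (!st && !sv)) = true := by cases bB1 <;> simp_all
  have g6 : (!bB2 || (!st && !su)) = true := by cases bB2 <;> simp_all
  have g7 : (!aB1 || !bB2) = true := by cases aB1 <;> simp_all
  exact slots_count_le_five_bool st stu stv su sv aA aB1 aB2 bA bB1 bB2
    (by rw [g1, g2, g3, g4, g5, g6, g7]; rfl)

/-- Length of a filtered `cons`. -/
theorem length_filter_cons_toNat {α : Type*} (p : α → Bool) (a : α) (l : List α) :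
    ((a :: l).filter p).length = (p a).toNat + (l.filter p).length := by
  rw [List.filter_cons]
  cases p a <;> simp [Nat.add_comm]

/-! ### The six basal blocking distances -/

/-- The twin hollows `A = (1,−1,−1)+w`, `B₁ = (1,0,−1)+w`, `B₂ = (1,−1,0)+w` are at squared distance
`1/3` from their two adjacent up-bonds among `t, t − u, t − v`. -/
theorem twinHollow_block_norms :
    ‖(barlowPos 1 (Real.sqrt (2 / 3)) constHagg 1 (-1) (-1) + barlowOffset 1) -
        (barlowPos 1 (Real.sqrt (2 / 3)) constHagg 1 0 0 - barlowPos 1 (Real.sqrt (2 / 3)) constHagg 0 1 0)‖ ^ 2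
      = 1 / 3 ∧
    ‖(barlowPos 1 (Real.sqrt (2 / 3)) constHagg 1 (-1) (-1) + barlowOffset 1) -
        (barlowPos 1 (Real.sqrt (2 / 3)) constHagg 1 0 0 - barlowPos 1 (Real.sqrt (2 / 3)) constHagg 0 0 1)‖ ^ 2
      = 1 / 3 ∧
    ‖(barlowPos 1 (Real.sqrt (2 / 3)) constHagg 1 0 (-1) + barlowOffset 1) -
        barlowPos 1 (Real.sqrt (2 / 3)) constHagg 1 0 0‖ ^ 2 = 1 / 3 ∧
    ‖(barlowPos 1 (Real.sqrt (2 / 3)) constHagg 1 0 (-1) + barlowOffset 1) -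
        (barlowPos 1 (Real.sqrt (2 / 3)) constHagg 1 0 0 - barlowPos 1 (Real.sqrt (2 / 3)) constHagg 0 0 1)‖ ^ 2
      = 1 / 3 ∧
    ‖(barlowPos 1 (Real.sqrt (2 / 3)) constHagg 1 (-1) 0 + barlowOffset 1) -
        barlowPos 1 (Real.sqrt (2 / 3)) constHagg 1 0 0‖ ^ 2 = 1 / 3 ∧
    ‖(barlowPos 1 (Real.sqrt (2 / 3)) constHagg 1 (-1) 0 + barlowOffset 1) -
        (barlowPos 1 (Real.sqrt (2 / 3)) constHagg 1 0 0 - barlowPos 1 (Real.sqrt (2 / 3)) constHagg 0 1 0)‖ ^ 2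
      = 1 / 3 := by
  have h3 : Real.sqrt 3 ^ 2 = 3 := Real.sq_sqrt (by norm_num)
  have hh : Real.sqrt (2 / 3) ^ 2 = 2 / 3 := Real.sq_sqrt (by norm_num)
  refine ⟨?_, ?_, ?_, ?_, ?_, ?_⟩ <;>
  · rw [EuclideanSpace.real_norm_sq_eq, Fin.sum_univ_three]
    simp [barlowOffset, barlowPos_apply_zero, barlowPos_apply_one, barlowPos_apply_two]
    nlinarith [h3, hh]

end Summit.Ventures.Crystal3D.Theorems

end
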